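import Mathlib
import HarnessLib
import Literature.GroupTheory.CombinatorialGroupTheory.SignedHurwitzAction
import Literature.GroupTheory.CombinatorialGroupTheory.SignedHurwitzStabilisation

/-!
# Stub `stub_reachInvariants` of line `modp-braid-orbits` for crux `ConvexBisection.AcyclicBisectionExists`
(item stmt-SmoothPoincare4-10508, route route-SmoothPoincare4-ConvexBisection)

Pure algebra over `ℤ` for the signed Hurwitz calculus
(`Literature.GroupTheory.CombinatorialGroupTheory.SignedHurwitzAction` and
`…SignedHurwitzStabilisation`) on integral signed words `IntWord g` (letters in `ℤ^{2g}` with the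
standard symplectic pairing `stdSymp ℤ g`, and a sign).

**Statement.** If `(g', l')` is reachable from `(g, l)` (`Reach g l g' l'`: finitely many signed
Hurwitz moves at the current genus and stabilisation-pair moves `StabStep`, in any order) and the
signed monodromy of `l` is trivial, `wordProduct (stdSymp ℤ g) l = 1`, then so is the signed
monodromy of `l'`.

**Proof.** Induction on `Reach`; two one-step facts at an arbitrary genus `n`.
* HURWITZ MOVE (`ReachInvariants.wordProduct_eq_of_hurwitzStep`): for any alternating pairing `B`
  over a commutative ring the identities `T_{T_a^{ε} b} T_a^{ε} = T_a^{ε} T_b^{ε'}` and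
  `T_b^{ε'} T_{T_b^{-ε'} a}^{ε} = T_a^{ε} T_b^{ε'}` hold in `Module.End R V` (expand
  `transvection_apply`, kill `B v v = 0`, use skewness), so one move leaves `wordProduct` unchanged.
* STABILISATION-PAIR MOVE (`ReachInvariants.wordProduct_of_stabStep`):
  `T_v⁺ T_v⁻ = 1`, so the block `(e + c, +) (f, +) (f, −) (e + c, −)` has trivial monodromy
  (`wordProduct_stabBlock`); an embedded letter `(embed x, ε)` acts on
  `z = embed y + a e + b f` as `embed (T_x^{ε} y) + a e + b f` (`embed` is isometric and
  orthogonal to `e, f`), hence by induction an embedded word acts by the old monodromy on the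
  `embed` summand and trivially on `⟨e, f⟩` (`wordProduct_mapWord_embed_apply`); since every `z`
  has this form (`exists_eq_embed_add`), `embed A ++ block ++ embed B` has monodromy
  `W(embed (A ++ B)) = 1` when `W(A ++ B) = 1`.
-/

noncomputable section

-- the prescribed namespace `Summit.<P>.<Sub>.…` duplicates `SmoothPoincare4` (P = Sub)
set_option linter.dupNamespace false

namespace Summit.SmoothPoincare4.SmoothPoincare4.Theorems.AcyclicBisectionExists.ModpBraidOrbits

open Literature.GroupTheory.CombinatorialGroupTheory.SignedHurwitz

namespace ReachInvariants

/-! ## Signed transvections for an alternating pairing over a commutative ring -/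

section General

variable {R : Type*} [CommRing R] {V : Type*} [AddCommGroup V] [Module R V]
  (B : V →ₗ[R] V →ₗ[R] R)

/-- First Hurwitz identity `T_{T_a b} (T_a y) = T_a (T_b y)` (signed), for an alternating pairing
over a commutative ring. -/
theorem transvection_hurwitz₁ (hB : ∀ x, B x x = 0) (a : V) (sa : Bool) (b : V) (sb : Bool)
    (y : V) :
    transvection B (b + (sgn sa * B a b) • a, sb) (transvection B (a, sa) y) =
      transvection B (a, sa) (transvection B (b, sb) y) := by
  have hs : B b a = -B a b := by
    have h := hB (a + b)
    simp only [map_add, LinearMap.add_apply, hB, zero_add, add_zero] at h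
    linear_combination h
  simp only [transvection_apply, map_add, map_smul, LinearMap.add_apply, LinearMap.smul_apply,
    smul_eq_mul, hB, hs]
  module

/-- Second Hurwitz identity `T_b (T_{T_b⁻¹ a} y) = T_a (T_b y)` (signed), for an alternating
pairing over a commutative ring. -/
theorem transvection_hurwitz₂ (hB : ∀ x, B x x = 0) (a : V) (sa : Bool) (b : V) (sb : Bool)
    (y : V) :
    transvection B (b, sb) (transvection B (a - (sgn sb * B b a) • b, sa) y) =
      transvection B (a, sa) (transvection B (b, sb) y) := by
  have hs : B b a = -B a b := by
    have h := hB (a + b)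
    simp only [map_add, LinearMap.add_apply, hB, zero_add, add_zero] at h
    linear_combination h
  simp only [transvection_apply, map_add, map_smul, map_sub, LinearMap.smul_apply,
    LinearMap.sub_apply, smul_eq_mul, hB, hs]
  module

/-- A positive and a negative transvection along the same class cancel: `T_v⁺ (T_v⁻ y) = y`. -/
theorem transvection_true_false_apply (hB : ∀ x, B x x = 0) (v y : V) :
    transvection B (v, true) (transvection B (v, false) y) = y := by
  simp only [transvection_apply, map_add, map_smul, hB, sgn_true, sgn_false]
  module

/-- A signed Hurwitz move does not change the signed monodromy. -/
theorem wordProduct_eq_of_hurwitzStep (hB : ∀ x, B x x = 0) {l l' : List (V × Bool)}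
    (h : HurwitzStep B l l') : wordProduct B l' = wordProduct B l := by
  obtain ⟨pre, suf, ⟨a, sa⟩, ⟨b, sb⟩, rfl, rfl | rfl⟩ := h
  · refine LinearMap.ext fun y => ?_
    simp only [wordProduct_append, wordProduct_cons, Module.End.mul_apply,
      transvection_hurwitz₁ B hB]
  · refine LinearMap.ext fun y => ?_
    simp only [wordProduct_append, wordProduct_cons, Module.End.mul_apply,
      transvection_hurwitz₂ B hB]

end General

/-! ## The standard symplectic lattice and the stabilisation-pair move -/

/-- The standard symplectic pairing over `ℤ` is alternating. -/
theorem stdSymp_int_self (n : ℕ) (x : Fin n ⊕ Fin n → ℤ) : stdSymp ℤ n x x = 0 := by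
  rw [stdSymp_int_apply]
  exact Finset.sum_eq_zero fun i _ => by ring

/-- An embedded letter acts on `ℤ^{2n+2} = embed (ℤ^{2n}) ⊕ ⟨e, f⟩` by the old transvection on the
first summand and trivially on the new pair. -/
theorem transvection_embed_apply (n : ℕ) (x : (Fin n ⊕ Fin n → ℤ) × Bool) (y : Fin n ⊕ Fin n → ℤ)
    (a b : ℤ) :
    transvection (stdSymp ℤ (n + 1)) (embed n x.1, x.2) (embed n y + a • newE n + b • newF n) =
      embed n (transvection (stdSymp ℤ n) x y) + a • newE n + b • newF n := by
  rw [transvection_apply, transvection_apply]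
  simp only [map_add, map_smul, smul_eq_mul, stdSymp_embed_embed, stdSymp_embed_newE,
    stdSymp_embed_newF, mul_zero, add_zero, embed_add, embed_smul]
  abel

/-- The monodromy of an embedded word acts by the old monodromy on the first summand of
`ℤ^{2n+2} = embed (ℤ^{2n}) ⊕ ⟨e, f⟩` and trivially on the new pair. -/
theorem wordProduct_mapWord_embed_apply (n : ℕ) (w : IntWord n) (y : Fin n ⊕ Fin n → ℤ)
    (a b : ℤ) :
    wordProduct (stdSymp ℤ (n + 1)) (mapWord (embed n) w) (embed n y + a • newE n + b • newF n) =
      embed n (wordProduct (stdSymp ℤ n) w y) + a • newE n + b • newF n := by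
  induction w with
  | nil => simp
  | cons x w ih =>
    rw [mapWord_cons, wordProduct_cons, wordProduct_cons, Module.End.mul_apply,
      Module.End.mul_apply, ih, transvection_embed_apply]

/-- A word with trivial monodromy at genus `n` still has trivial monodromy after the genus-raising
embedding. -/
theorem wordProduct_mapWord_embed (n : ℕ) {w : IntWord n} (hw : wordProduct (stdSymp ℤ n) w = 1) :
    wordProduct (stdSymp ℤ (n + 1)) (mapWord (embed n) w) = 1 := by
  refine LinearMap.ext fun z => ?_
  obtain ⟨y, a, b, rfl⟩ := exists_eq_embed_add n z
  rw [wordProduct_mapWord_embed_apply, hw, Module.End.one_apply, Module.End.one_apply]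

/-- The stabilisation block `(e + c, +) (f, +) (f, −) (e + c, −)` has trivial monodromy. -/
theorem wordProduct_stabBlock (n : ℕ) (c : Fin n ⊕ Fin n → ℤ) :
    wordProduct (stdSymp ℤ (n + 1)) (stabBlock n c) = 1 := by
  refine LinearMap.ext fun y => ?_
  simp only [stabBlock, wordProduct_cons, wordProduct_nil, Module.End.mul_apply,
    Module.End.one_apply, transvection_true_false_apply _ (stdSymp_int_self (n + 1))]

/-- A stabilisation-pair move takes words with trivial monodromy to words with trivial
monodromy. -/
theorem wordProduct_of_stabStep {n : ℕ} {l : IntWord n} {l' : IntWord (n + 1)}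
    (h : StabStep n l l') (hl : wordProduct (stdSymp ℤ n) l = 1) :
    wordProduct (stdSymp ℤ (n + 1)) l' = 1 := by
  obtain ⟨A, B, c, -, rfl, rfl⟩ := h
  rw [wordProduct_append, wordProduct_append, wordProduct_stabBlock, mul_one, ← wordProduct_append,
    ← mapWord_append]
  exact wordProduct_mapWord_embed n hl

end ReachInvariants

/-- **Stub `stub_reachInvariants`.**  Along the reachability relation `Reach` (signed Hurwitz
moves for the standard symplectic pairing `stdSymp ℤ` at the current genus, and stabilisation-pair
moves `StabStep`, in any order) triviality of the signed monodromy `wordProduct (stdSymp ℤ _) _ = 1`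
is preserved.

Proof: induction on `Reach`.  A Hurwitz move preserves the monodromy of any word for any
alternating pairing over a commutative ring, by the two identities `T_{T_a b} T_a = T_a T_b`,
`T_b T_{T_b⁻¹ a} = T_a T_b` in `Module.End ℤ ℤ^{2n}` (`ReachInvariants.transvection_hurwitz₁/₂`;
only `ω(x, x) = 0` and skew-symmetry are used).  For a stabilisation-pair move
`A ++ B ↦ embed A ++ [(e + c, +), (f, +), (f, −), (e + c, −)] ++ embed B`: the block has trivial
monodromy since `T_v⁺ T_v⁻ = 1`, and an embedded word acts on
`ℤ^{2n+2} = embed (ℤ^{2n}) ⊕ ⟨e, f⟩` by the old monodromy on the first summand and trivially on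
`⟨e, f⟩` (`embed` is isometric and orthogonal to `e, f`), so `embed (A ++ B)` has trivial
monodromy when `A ++ B` has. [folklore] -/
theorem stub_reachInvariants :
    ∀ (g : ℕ) (l : IntWord g) (g' : ℕ) (l' : IntWord g'),
      Reach g l g' l' → wordProduct (stdSymp ℤ g) l = 1 → wordProduct (stdSymp ℤ g') l' = 1 := by
  intro g l g' l' h
  induction h with
  | refl => exact id
  | hurwitz _ hstep ih =>
    exact fun hl => (ReachInvariants.wordProduct_eq_of_hurwitzStep _
      (ReachInvariants.stdSymp_int_self _) hstep).trans (ih hl)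
  | stab _ hstep ih => exact fun hl => ReachInvariants.wordProduct_of_stabStep hstep (ih hl)

end Summit.SmoothPoincare4.SmoothPoincare4.Theorems.AcyclicBisectionExists.ModpBraidOrbits

end
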